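/-
Origin: expansion seat `planner-pub-hodgecm-toy-g5-0`, handover #8 2026-08-18T15:51:11Z (md5 3a32662c) (`HOME/pub-hodgecm-toy-g5/lean/ToyG5/HodgeQuotientForm3.lean`, md5 3a32662c, 282 lines);
landed by the gen-8 packager in gate run 31 as `HodgeCM/Model/ToyG2/HodgeQuotientForm3.lean` (import ^import ToyG5\.HodgeQuotient3[ \t]*$→import HodgeCM.Model.ToyG2.HodgeQuotient3 ×1).
-/
-- HANDOVER (planner-pub-hodgecm-toy-g5-0, unit pub-hodgecm-toy-g5): WIP module `ToyG5.HodgeQuotientForm3`; intended final module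
-- `HodgeCM.Model.ToyG2.HodgeQuotientForm3` (kind L5, toy model / consistency witness, EXPANSION part (e), generation 5);
-- rename `import ToyG5.X` ↦ `import HodgeCM.Model.ToyG2.X` (one import: `HodgeQuotient3`, file #7 of this seat).
/-
Copyright (c) 2026. All rights reserved.
Released under Apache 2.0 license as described in the file LICENSE.
-/
import Mathlib
import Summits.HodgeConjecture.HodgeCM.Model.ToyG2.HodgeQuotient3

/-!
# The induced trace pairing on `H²(P_Γ, ℚ) ⧸ N_ℚ`: nondegenerate, symmetric, and positive on `F²`

File #8 of generation 5 of the toy lineage (seat `planner-pub-hodgecm-toy-g5-0`).  File #7 built the quotient Hodge structure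
`hr3t_quotHodge d t ι₁ Γ : HodgeStructure (H²(P_Γ, ℚ) ⧸ N_ℚ) 2` (`N_ℚ = Universe.trCupRad _ P_Γ 2`, the radical of the rational
pairing `tr(x ∪ y)` on `H²(P_Γ) = ⋀²H¹`) and proved HR20 on it in LIFTED form.  This file descends the pairing itself:

* §1 (GENERIC, namespace `HodgeCM.QuotForm`; `B : LinearMap.BilinForm ℚ V`, `N : Submodule ℚ V` killed by `B` on both sides):
  the induced form **`QuotForm.liftQ₂ B N hl hr : LinearMap.BilinForm ℚ (V ⧸ N)`** (`liftQ₂_mk : B̄ [x] [y] = B x y`), symmetric if `B`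
  is (`liftQ₂_symm`), **nondegenerate when `N` is the full left radical** (`liftQ₂_nondegenerate`), and compatible with complexification:
  `(B̄ ⊗ ℂ) (π_ℂ x) (π_ℂ y) = (B ⊗ ℂ) x y` for `π_ℂ = N.mkQ ⊗ ℂ` (`baseChange_liftQ₂_mkQ`);
* §2 (GENERIC `Universe`): `Universe.trC_cup2C_eq_baseChange : tr_ℂ(x ∪_ℂ y) = (trCup ⊗ ℂ) x y`;
* §3 (toy, any `d t`): `hr3u_trCup_symm` (graded symmetry in even degree), the induced rational pairing
  **`hr3u_formQ d t ι₁ Γ : LinearMap.BilinForm ℚ (H²(P_Γ, ℚ) ⧸ N_ℚ)`** — symmetric (`hr3u_formQ_symm`), **nondegenerate**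
  (`hr3u_formQ_nondegenerate`) —, its complexification `hr3u_formQC` with `hr3u_formQC_mkQ : formQ_ℂ (π_ℂ η) (π_ℂ ζ) = tr_ℂ(η ∪ ζ)` and
  `hr3u_formQC_conj_eq_lift` (the Hodge–Riemann form of the quotient, evaluated through any lift);
* §4 (toy, `1 ≤ d`, `t² = 16`): **`hr3u_HR20_quotForm`** — for every nonzero `ξ ∈ F²` of the quotient Hodge structure,
  `formQ_ℂ(ξ, conj ξ) ≠ 0`, indeed (`hr3u_HR20_quotForm_pos`) it is a POSITIVE REAL: `0 < re` and `im = 0` — i.e. the genuine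
  Hodge–Riemann bilinear relation HR20 for the polarised weight-2 quotient `(H²(P_Γ, ℚ) ⧸ N_ℚ, formQ)`, stated intrinsically on the
  quotient (no lifts in the statement); `hr3u_quotForm_summary` packages nondegeneracy, symmetry, `F² ≠ 0` and positivity.

Nothing cited, nothing posited, no unfinished proofs.
-/

open scoped TensorProduct
open Literature.AlgebraicGeometry.Motives
open Literature.AlgebraicGeometry.Motives.HodgeStructure (conj complexConj conj_smul conj_conj conj_baseChange
  mem_complexConj complexConj_mono)

namespace HodgeCM

noncomputable section

/-! ### §1 Descending a bilinear form to the quotient by (a subspace of) its radical (generic) -/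

namespace QuotForm

universe u

variable {V : Type u} [AddCommGroup V] [Module ℚ V] (B : LinearMap.BilinForm ℚ V) (N : Submodule ℚ V)
  (hl : ∀ x ∈ N, ∀ y, B x y = 0) (hr : ∀ y ∈ N, ∀ x, B x y = 0)

/-- the bilinear form induced on `V ⧸ N` by a bilinear form `B` on `V` vanishing on `N × V` and on `V × N` -/
def liftQ₂ : LinearMap.BilinForm ℚ (V ⧸ N) :=
  N.liftQ (N.liftQ (LinearMap.flip B) (fun y hy => LinearMap.mem_ker.mpr (LinearMap.ext fun x => hr y hy x))).flip
    (fun x hx => LinearMap.mem_ker.mpr (LinearMap.ext fun yq => by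
      obtain ⟨y, rfl⟩ := N.mkQ_surjective yq
      change B x y = 0
      exact hl x hx y))

/-- (Ported verbatim from the HodgeCMPerL package; no docstring in the source.) -/
@[simp] theorem liftQ₂_mk (x y : V) :
    liftQ₂ B N hl hr (Submodule.Quotient.mk x) (Submodule.Quotient.mk y) = B x y := rfl

/-- (Ported verbatim from the HodgeCMPerL package; no docstring in the source.) -/
theorem liftQ₂_mkQ (x y : V) : liftQ₂ B N hl hr (N.mkQ x) (N.mkQ y) = B x y := rfl

/-- the induced form is symmetric if `B` is -/
theorem liftQ₂_symm (hB : ∀ x y, B x y = B y x) (xq yq : V ⧸ N) :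
    liftQ₂ B N hl hr xq yq = liftQ₂ B N hl hr yq xq := by
  obtain ⟨x, rfl⟩ := N.mkQ_surjective xq
  obtain ⟨y, rfl⟩ := N.mkQ_surjective yq
  rw [liftQ₂_mkQ, liftQ₂_mkQ, hB]

/-- **nondegeneracy**: if `N` contains the whole left radical of `B`, the induced form on `V ⧸ N` has trivial left radical -/
theorem liftQ₂_nondegenerate (hN : ∀ x, (∀ y, B x y = 0) → x ∈ N) (xq : V ⧸ N)
    (h : ∀ yq, liftQ₂ B N hl hr xq yq = 0) : xq = 0 := by
  obtain ⟨x, rfl⟩ := N.mkQ_surjective xq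
  rw [Submodule.mkQ_apply, Submodule.Quotient.mk_eq_zero]
  exact hN x fun y => by rw [← liftQ₂_mkQ B N hl hr x y]; exact h _

/-- as a statement about the associated linear map `V ⧸ N → (V ⧸ N)^*`: it is injective -/
theorem liftQ₂_ker_eq_bot (hN : ∀ x, (∀ y, B x y = 0) → x ∈ N) : LinearMap.ker (liftQ₂ B N hl hr) = ⊥ := by
  refine (Submodule.eq_bot_iff _).mpr fun xq hx => liftQ₂_nondegenerate B N hl hr hN xq fun yq => ?_
  rw [LinearMap.mem_ker.mp hx, LinearMap.zero_apply]

/-- compatibility with complexification: `(B̄ ⊗ ℂ) (π_ℂ x) (π_ℂ y) = (B ⊗ ℂ) x y`, `π_ℂ = N.mkQ ⊗ ℂ` -/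
theorem baseChange_liftQ₂_mkQ (x y : ℂ ⊗[ℚ] V) :
    (liftQ₂ B N hl hr).baseChange ℂ (N.mkQ.baseChange ℂ x) (N.mkQ.baseChange ℂ y)
      = LinearMap.BilinForm.baseChange ℂ B x y := by
  induction x using TensorProduct.induction_on with
  | zero => simp only [map_zero, LinearMap.zero_apply]
  | add x₁ x₂ h₁ h₂ => simp only [map_add, LinearMap.add_apply, h₁, h₂]
  | tmul a v =>
    induction y using TensorProduct.induction_on with
    | zero => simp only [map_zero]
    | add y₁ y₂ h₁ h₂ => simp only [map_add, h₁, h₂]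
    | tmul b w =>
      simp only [LinearMap.baseChange_tmul, LinearMap.BilinForm.baseChange_tmul, liftQ₂_mkQ]

end QuotForm

/-! ### §2 The induced pairing on `H^k(X, ℚ) ⧸ N_ℚ` for a symmetric trace pairing (generic `Universe`) -/

namespace Universe

variable (U : Universe) (X : U.Var) (k : ℕ)

/-- the complex trace pairing `tr_ℂ(x ∪_ℂ y)` is the complexification of the rational one -/
theorem trC_cup2C_eq_baseChange (x y : U.CohC X k) :
    U.trC X (k + k) (U.cup2C X k x y) = LinearMap.BilinForm.baseChange ℂ (U.trCup X k) x y := by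
  induction x using TensorProduct.induction_on with
  | zero => simp only [map_zero, LinearMap.zero_apply]
  | add x₁ x₂ h₁ h₂ => simp only [map_add, LinearMap.add_apply, h₁, h₂]
  | tmul a v =>
    induction y using TensorProduct.induction_on with
    | zero => simp only [map_zero]
    | add y₁ y₂ h₁ h₂ => simp only [map_add, h₁, h₂]
    | tmul b w => rw [trC_cup2C_tmul, LinearMap.BilinForm.baseChange_tmul, trCup_apply]

/-- the rational radical is killed by the rational pairing on the left … -/
theorem trCup_rad_left (x : U.Coh X k) (hx : x ∈ U.trCupRad X k) (y : U.Coh X k) : U.trCup X k x y = 0 :=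
  (U.mem_trCupRad_iff X k x).mp hx y

/-- (Ported verbatim from the HodgeCMPerL package; no docstring in the source.) -/
theorem mem_trCupRad_of_forall (x : U.Coh X k) (hx : ∀ y, U.trCup X k x y = 0) : x ∈ U.trCupRad X k :=
  (U.mem_trCupRad_iff X k x).mpr hx

variable (hsym : ∀ x y : U.Coh X k, U.trCup X k x y = U.trCup X k y x)
include hsym

/-- … and, for a symmetric pairing, on the right -/
theorem trCup_rad_right (y : U.Coh X k) (hy : y ∈ U.trCupRad X k) (x : U.Coh X k) : U.trCup X k x y = 0 := by
  rw [hsym]; exact U.trCup_rad_left X k y hy x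

/-- **the induced rational pairing** `trCupQ([x], [y]) = tr(x ∪ y)` on `H^k(X, ℚ) ⧸ N_ℚ`, for a symmetric trace pairing -/
def trCupQ : LinearMap.BilinForm ℚ (U.Coh X k ⧸ U.trCupRad X k) :=
  QuotForm.liftQ₂ (U.trCup X k) _ (U.trCup_rad_left X k) (U.trCup_rad_right X k hsym)

/-- (Ported verbatim from the HodgeCMPerL package; no docstring in the source.) -/
theorem trCupQ_mkQ (x y : U.Coh X k) :
    U.trCupQ X k hsym ((U.trCupRad X k).mkQ x) ((U.trCupRad X k).mkQ y) = U.tr X (k + k) (U.cup X k k x y) := rfl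

/-- the induced pairing is symmetric … -/
theorem trCupQ_symm (xq yq : U.Coh X k ⧸ U.trCupRad X k) : U.trCupQ X k hsym xq yq = U.trCupQ X k hsym yq xq :=
  QuotForm.liftQ₂_symm _ _ _ _ hsym xq yq

/-- … and **nondegenerate** -/
theorem trCupQ_nondegenerate (xq : U.Coh X k ⧸ U.trCupRad X k) (h : ∀ yq, U.trCupQ X k hsym xq yq = 0) : xq = 0 :=
  QuotForm.liftQ₂_nondegenerate _ _ _ _ (U.mem_trCupRad_of_forall X k) xq h

/-- (Ported verbatim from the HodgeCMPerL package; no docstring in the source.) -/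
theorem trCupQ_ker_eq_bot : LinearMap.ker (U.trCupQ X k hsym) = ⊥ :=
  QuotForm.liftQ₂_ker_eq_bot _ _ _ _ (U.mem_trCupRad_of_forall X k)

/-- the complexified induced pairing on `(H^k(X, ℚ) ⧸ N_ℚ) ⊗ ℂ` -/
def trCupQC : LinearMap.BilinForm ℂ (ℂ ⊗[ℚ] (U.Coh X k ⧸ U.trCupRad X k)) :=
  LinearMap.BilinForm.baseChange ℂ (U.trCupQ X k hsym)

/-- `trCupQ_ℂ (π_ℂ η) (π_ℂ ζ) = tr_ℂ(η ∪ ζ)` -/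
theorem trCupQC_mkQ (η ζ : U.CohC X k) :
    U.trCupQC X k hsym ((U.trCupRad X k).mkQ.baseChange ℂ η) ((U.trCupRad X k).mkQ.baseChange ℂ ζ)
      = U.trC X (k + k) (U.cup2C X k η ζ) := by
  rw [trCupQC, trCupQ, QuotForm.baseChange_liftQ₂_mkQ, trC_cup2C_eq_baseChange]

/-- the Hodge–Riemann form of the quotient through a lift: `trCupQ_ℂ (π_ℂ η) (conj (π_ℂ η)) = tr_ℂ(η ∪ conj η)` -/
theorem trCupQC_conj_eq_lift (η : U.CohC X k) :
    U.trCupQC X k hsym ((U.trCupRad X k).mkQ.baseChange ℂ η) (conj ((U.trCupRad X k).mkQ.baseChange ℂ η))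
      = U.trC X (k + k) (U.cup2C X k η (conj η)) := by
  rw [conj_baseChange, trCupQC_mkQ]

end Universe

/-! ### §3 The induced pairing on `H²(P_Γ, ℚ) ⧸ N_ℚ` (toy, any `d t`) -/

namespace ToyG2

open HodgeCM.Toy HodgeCM.Toy.CMPresentation ThetaUiso

variable (d t : ℚ) {L : CMField} (ι₁ : L →+* ℂ) {V : HermSpace3 L ι₁} (Γ : Level V)

/-- graded symmetry of the trace pairing in degree `2`: `tr(x ∪ y) = tr(y ∪ x)` on `H²(P_Γ, ℚ) = ⋀²H¹` -/
theorem hr3u_trCup_symm (x y : (toyUniverse₃ d t).Coh ((toyUniverse₃ d t).pms L ι₁ V Γ) 2) :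
    (toyUniverse₃ d t).trCup ((toyUniverse₃ d t).pms L ι₁ V Γ) 2 x y
      = (toyUniverse₃ d t).trCup ((toyUniverse₃ d t).pms L ι₁ V Γ) 2 y x := by
  rw [Universe.trCup_apply, Universe.trCup_apply]
  show trOf ((toyUniverse₃ d t).pms L ι₁ V Γ).X (2 + 2) (Toy.wedge ℚ ((toyUniverse₃ d t).pms L ι₁ V Γ).X.L 2 2 x y)
    = trOf ((toyUniverse₃ d t).pms L ι₁ V Γ).X (2 + 2) (Toy.wedge ℚ ((toyUniverse₃ d t).pms L ι₁ V Γ).X.L 2 2 y x)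
  rw [trOf_wedge_comm]; norm_num

/-- **the induced rational pairing** `formQ([x], [y]) = tr(x ∪ y)` on `H²(P_Γ, ℚ) ⧸ N_ℚ` (any `d t`): symmetric and nondegenerate -/
def hr3u_formQ : LinearMap.BilinForm ℚ ((toyUniverse₃ d t).Coh ((toyUniverse₃ d t).pms L ι₁ V Γ) 2
      ⧸ (toyUniverse₃ d t).trCupRad ((toyUniverse₃ d t).pms L ι₁ V Γ) 2) :=
  (toyUniverse₃ d t).trCupQ ((toyUniverse₃ d t).pms L ι₁ V Γ) 2 (hr3u_trCup_symm d t ι₁ Γ)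

/-- (Ported verbatim from the HodgeCMPerL package; no docstring in the source.) -/
theorem hr3u_formQ_mkQ (x y : (toyUniverse₃ d t).Coh ((toyUniverse₃ d t).pms L ι₁ V Γ) 2) :
    hr3u_formQ d t ι₁ Γ (((toyUniverse₃ d t).trCupRad ((toyUniverse₃ d t).pms L ι₁ V Γ) 2).mkQ x)
        (((toyUniverse₃ d t).trCupRad ((toyUniverse₃ d t).pms L ι₁ V Γ) 2).mkQ y)
      = (toyUniverse₃ d t).tr ((toyUniverse₃ d t).pms L ι₁ V Γ) (2 + 2)
          ((toyUniverse₃ d t).cup ((toyUniverse₃ d t).pms L ι₁ V Γ) 2 2 x y) :=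
  (toyUniverse₃ d t).trCupQ_mkQ _ 2 _ x y

/-- (Ported verbatim from the HodgeCMPerL package; no docstring in the source.) -/
theorem hr3u_formQ_symm (xq yq : (toyUniverse₃ d t).Coh ((toyUniverse₃ d t).pms L ι₁ V Γ) 2
      ⧸ (toyUniverse₃ d t).trCupRad ((toyUniverse₃ d t).pms L ι₁ V Γ) 2) :
    hr3u_formQ d t ι₁ Γ xq yq = hr3u_formQ d t ι₁ Γ yq xq :=
  (toyUniverse₃ d t).trCupQ_symm _ 2 _ xq yq

/-- **the induced pairing on `H²(P_Γ, ℚ) ⧸ N_ℚ` is nondegenerate** (any `d t`) -/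
theorem hr3u_formQ_nondegenerate (xq : (toyUniverse₃ d t).Coh ((toyUniverse₃ d t).pms L ι₁ V Γ) 2
      ⧸ (toyUniverse₃ d t).trCupRad ((toyUniverse₃ d t).pms L ι₁ V Γ) 2)
    (h : ∀ yq, hr3u_formQ d t ι₁ Γ xq yq = 0) : xq = 0 :=
  (toyUniverse₃ d t).trCupQ_nondegenerate _ 2 _ xq h

/-- (Ported verbatim from the HodgeCMPerL package; no docstring in the source.) -/
theorem hr3u_formQ_ker_eq_bot : LinearMap.ker (hr3u_formQ d t ι₁ Γ) = ⊥ :=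
  (toyUniverse₃ d t).trCupQ_ker_eq_bot _ 2 _

/-- the complexified induced pairing on `(H²(P_Γ, ℚ) ⧸ N_ℚ) ⊗ ℂ` -/
def hr3u_formQC : LinearMap.BilinForm ℂ (ℂ ⊗[ℚ] ((toyUniverse₃ d t).Coh ((toyUniverse₃ d t).pms L ι₁ V Γ) 2
      ⧸ (toyUniverse₃ d t).trCupRad ((toyUniverse₃ d t).pms L ι₁ V Γ) 2)) :=
  (toyUniverse₃ d t).trCupQC ((toyUniverse₃ d t).pms L ι₁ V Γ) 2 (hr3u_trCup_symm d t ι₁ Γ)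

/-- `formQ_ℂ (π_ℂ η) (π_ℂ ζ) = tr_ℂ(η ∪ ζ)` -/
theorem hr3u_formQC_mkQ (η ζ : (toyUniverse₃ d t).CohC ((toyUniverse₃ d t).pms L ι₁ V Γ) 2) :
    hr3u_formQC d t ι₁ Γ (((toyUniverse₃ d t).trCupRad ((toyUniverse₃ d t).pms L ι₁ V Γ) 2).mkQ.baseChange ℂ η)
        (((toyUniverse₃ d t).trCupRad ((toyUniverse₃ d t).pms L ι₁ V Γ) 2).mkQ.baseChange ℂ ζ)
      = (toyUniverse₃ d t).trC ((toyUniverse₃ d t).pms L ι₁ V Γ) 4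
          ((toyUniverse₃ d t).cup2C ((toyUniverse₃ d t).pms L ι₁ V Γ) 2 η ζ) :=
  (toyUniverse₃ d t).trCupQC_mkQ _ 2 _ η ζ

/-- the Hodge–Riemann form of the quotient through a lift: `formQ_ℂ (π_ℂ η) (conj (π_ℂ η)) = tr_ℂ(η ∪ conj η)` -/
theorem hr3u_formQC_conj_eq_lift (η : (toyUniverse₃ d t).CohC ((toyUniverse₃ d t).pms L ι₁ V Γ) 2) :
    hr3u_formQC d t ι₁ Γ (((toyUniverse₃ d t).trCupRad ((toyUniverse₃ d t).pms L ι₁ V Γ) 2).mkQ.baseChange ℂ η)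
        (conj (((toyUniverse₃ d t).trCupRad ((toyUniverse₃ d t).pms L ι₁ V Γ) 2).mkQ.baseChange ℂ η))
      = (toyUniverse₃ d t).trC ((toyUniverse₃ d t).pms L ι₁ V Γ) 4
          ((toyUniverse₃ d t).cup2C ((toyUniverse₃ d t).pms L ι₁ V Γ) 2 η (conj η)) :=
  (toyUniverse₃ d t).trCupQC_conj_eq_lift _ 2 _ η

/-! ### §4 HR20 for the polarised quotient `(H²(P_Γ, ℚ) ⧸ N_ℚ, formQ)` (toy, `1 ≤ d`, `t² = 16`) -/

section HR

variable (hd : (1 : ℚ) ≤ d) (ht : t ^ 2 = 16)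
include hd ht

/-- **HR20 for the quotient, intrinsic form**: `formQ_ℂ(ξ, conj ξ) ≠ 0` for every nonzero `ξ ∈ F²(H²(P_Γ) ⧸ N_ℚ)_ℂ` -/
theorem hr3u_HR20_quotForm
    (ξ : ℂ ⊗[ℚ] ((toyUniverse₃ d t).Coh ((toyUniverse₃ d t).pms L ι₁ V Γ) 2
      ⧸ (toyUniverse₃ d t).trCupRad ((toyUniverse₃ d t).pms L ι₁ V Γ) 2))
    (hξ : ξ ∈ (hr3t_quotHodge d t ι₁ Γ).F 2) (hξ0 : ξ ≠ 0) :
    hr3u_formQC d t ι₁ Γ ξ (conj ξ) ≠ 0 := by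
  obtain ⟨⟨η, hη, rfl⟩, hall⟩ := hr3t_HR20_quot d t ι₁ Γ hd ht ξ hξ hξ0
  rw [hr3u_formQC_conj_eq_lift]
  exact hall η hη rfl

/-- **HR20 for the quotient with sign**: `formQ_ℂ(ξ, conj ξ)` is a POSITIVE REAL for every nonzero `ξ ∈ F²(H²(P_Γ) ⧸ N_ℚ)_ℂ` -/
theorem hr3u_HR20_quotForm_pos
    (ξ : ℂ ⊗[ℚ] ((toyUniverse₃ d t).Coh ((toyUniverse₃ d t).pms L ι₁ V Γ) 2
      ⧸ (toyUniverse₃ d t).trCupRad ((toyUniverse₃ d t).pms L ι₁ V Γ) 2))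
    (hξ : ξ ∈ (hr3t_quotHodge d t ι₁ Γ).F 2) (hξ0 : ξ ≠ 0) :
    0 < (hr3u_formQC d t ι₁ Γ ξ (conj ξ)).re ∧ (hr3u_formQC d t ι₁ Γ ξ (conj ξ)).im = 0 := by
  obtain ⟨⟨η, hη, rfl⟩, hall⟩ := hr3t_HR20_quot d t ι₁ Γ hd ht ξ hξ hξ0
  rw [hr3u_formQC_conj_eq_lift]
  have hnn := hr3g_HR_form_nonneg d t ι₁ Γ hd ht hη
  have hne := hall η hη rfl
  refine ⟨lt_of_le_of_ne hnn.1 fun h0 => hne (Complex.ext ?_ ?_), hnn.2⟩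
  · rw [Complex.zero_re]; exact h0.symm
  · rw [Complex.zero_im]; exact hnn.2

/-- packaged: **`(H²(P_Γ, ℚ) ⧸ N_ℚ, formQ)` is a weight-2 ℚ-Hodge structure with a nondegenerate symmetric rational pairing whose
Hodge–Riemann form is positive on the (nonzero) `F²`** — the polarisation-type data HR20 asks for, which `H²(P_Γ)` itself lacks
(file #1), `1 ≤ d`, `t² = 16` -/
theorem hr3u_quotForm_summary (q : Fin (nQ L ι₁)) :
    LinearMap.ker (hr3u_formQ d t ι₁ Γ) = ⊥ ∧
      (∀ xq yq, hr3u_formQ d t ι₁ Γ xq yq = hr3u_formQ d t ι₁ Γ yq xq) ∧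
      (hr3t_quotHodge d t ι₁ Γ).F 2 ≠ ⊥ ∧
      ∀ ξ ∈ (hr3t_quotHodge d t ι₁ Γ).F 2, ξ ≠ 0 →
        0 < (hr3u_formQC d t ι₁ Γ ξ (conj ξ)).re ∧ (hr3u_formQC d t ι₁ Γ ξ (conj ξ)).im = 0 :=
  ⟨hr3u_formQ_ker_eq_bot d t ι₁ Γ, hr3u_formQ_symm d t ι₁ Γ, hr3t_quot_F2_ne_bot d t ι₁ Γ hd ht q,
    fun ξ hξ hξ0 => hr3u_HR20_quotForm_pos d t ι₁ Γ hd ht ξ hξ hξ0⟩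

end HR

end ToyG2

end

end HodgeCM
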